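import Literature.NumberTheory.Transcendental.KZCubicalCalculus
import Literature.NumberTheory.Transcendental.KZMellinFibres
import Literature.NumberTheory.Transcendental.KZLogCalculusProofs

/-!
# `CubeKernelStep` (stmt-KontsevichZagierPeriods-17854), line `Sketch`, stub `stub_fibreNullOddReflection` (rung)

AN INTEGRAND ODD UNDER THE REFLECTION OF ONE COORDINATE REPRESENTS A RELATION (unconditional
torsion sanity check of the functional layer K1 of the crux: no `2[t]` obstruction).

Let `t` be an integral representation on the closed unit cube `[0,1]ⁿ` whose integrand satisfies
`t(update z i (1 − z i)) = −t(z)` on the cube. Then `[t] ∈ KZ.relations`: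

* rule (1a) (domain additivity across the null hyperplane `z i = ½`):
  `[t] − [t|_L] − [t|_U]` with `L = {z i ≤ ½}`, `U = {½ ≤ z i}` the two half cubes
  (`KZ.lowerHalfCube`, `KZ.upperHalfCube`, `KZCubicalCalculus.lean`);
* rule (2) along the box reflection `Φ z = update z i (1 − z i) = KZ.boxReflection i z`
  (an affine `ℚ`-polynomial involution with `|det DΦ| = 1`, landed as the move
  `KZ.of_sub_of_mem_relations_of_boxReflection`, `KZMellinFibres.lean`): `L = Φ ⁻¹' U` and on `L`
  the integrand of `t|_L` is `t = (−t) ∘ Φ` by oddness, so `[t|_L] − [(t|_U).neg]` is a relation;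
* rule (1b): `[t|_U] + [(t|_U).neg]` is a relation (`KZ.of_add_of_neg_mem_levelRel`);
* `[t] = ([t] − [t|_L] − [t|_U]) + ([t|_L] − [(t|_U).neg]) + ([t|_U] + [(t|_U).neg])`.

Dimension `0` needs no separate treatment (there is no coordinate `i : Fin 0`, and in any case
every lemma used is dimension-free). No definition is introduced.

References: M. Kontsevich, D. Zagier, *Periods* (2001), §1.2, rules (1), (2).
-/

noncomputable section

set_option linter.dupNamespace false

namespace Summit.KontsevichZagierPeriods.KontsevichZagierPeriods.Cruxes.CubeKernelStep.Layers

open MeasureTheory Set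
open Literature.NumberTheory.Transcendental
open Literature.NumberTheory.Transcendental.KZ
open Literature.ModelTheory.ExponentialFields (IsSemialgebraic)

/-! ## The reflection of one coordinate of the cube -/

/-- The reflection `z ↦ update z i (1 − z i)` is the box reflection `KZ.boxReflection i`.
[folklore] -/
theorem oddRefl_update_eq_boxReflection {n : ℕ} (i : Fin n) (z : Fin n → ℝ) :
    Function.update z i (1 - z i) = boxReflection i z := by
  funext k
  by_cases hk : k = i
  · subst hk
    simp [boxReflection]
  · simp [boxReflection, hk]

/-- The box reflection in the coordinate `i` preserves the closed unit cube. [folklore] -/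
theorem oddRefl_boxReflection_mem_cube_iff {n : ℕ} (i : Fin n) (x : Fin n → ℝ) :
    boxReflection i x ∈ cube n ↔ x ∈ cube n := by
  simp only [mem_cube]
  refine forall_congr' fun k => ?_
  by_cases hk : k = i
  · subst hk
    rw [boxReflection_apply_self]
    constructor <;> rintro ⟨h1, h2⟩ <;> constructor <;> linarith
  · rw [boxReflection_apply_of_ne hk]

/-- The lower half cube `{z i ≤ ½}` is the preimage of the upper half cube `{½ ≤ z i}` under the
reflection of the coordinate `i`. [folklore] -/
theorem oddRefl_lowerHalfCube_eq_preimage {n : ℕ} (i : Fin n) :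
    lowerHalfCube i = boxReflection i ⁻¹' upperHalfCube i := by
  ext x
  rw [mem_preimage, mem_lowerHalfCube, mem_upperHalfCube, oddRefl_boxReflection_mem_cube_iff,
    boxReflection_apply_self]
  constructor <;> rintro ⟨h1, h2⟩ <;> exact ⟨h1, by linarith⟩

/-! ## The rung -/

/-- RUNG (unconditional, K1-side torsion sanity): **an integrand odd under the reflection of one
coordinate represents a relation.** If the integrand of a closed `n`-cube representation satisfies
`t(update z i (1 − z i)) = −t(z)` on the cube, then `[t] ∈ relations`: split the cube at
`z i = 1/2` (rule (1a), the hyperplane is null), carry the lower half onto the upper half by the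
reflection `z ↦ update z i (1 − z i)` (rule (2), a `ℚ`-polynomial involution with `|det| = 1`),
where the transported integrand is `−t`, and cancel against the upper half (rule (1b)).
[cite: KontsevichZagier2001, §1.2 rule (2)] -/
theorem stub_fibreNullOddReflection :
    ∀ (n : ℕ) (i : Fin n) (t : IntegralRep n),
      t.domain = Set.pi Set.univ (fun _ : Fin n => Set.Icc (0:ℝ) 1) →
      (∀ z ∈ Set.pi Set.univ (fun _ : Fin n => Set.Icc (0:ℝ) 1),
        t.integrand (Function.update z i (1 - z i)) = -t.integrand z) →
      of t ∈ relations := by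
  intro n i t htd hodd
  rw [← cube_eq_pi] at htd hodd
  -- the two halves of `t`
  have hLsub : lowerHalfCube i ⊆ t.domain := htd ▸ lowerHalfCube_subset i
  have hUsub : upperHalfCube i ⊆ t.domain := htd ▸ upperHalfCube_subset i
  set tL : IntegralRep n := t.restrict (lowerHalfCube i) (isSemialgebraic_lowerHalfCube i) hLsub
    with htL
  set tU : IntegralRep n := t.restrict (upperHalfCube i) (isSemialgebraic_upperHalfCube i) hUsub
    with htU
  -- rule (1a): `[t] − [tL] − [tU]`
  have hadd : of t - of tL - of tU ∈ relations := by
    refine domainAddRel_subset_relations ⟨n, t, tL, tU, ?_, ?_, ?_, ?_, rfl⟩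
    · rw [htd, htL, htU, IntegralRep.domain_restrict, IntegralRep.domain_restrict,
        lowerHalfCube_union_upperHalfCube]
    · rw [htL, htU, IntegralRep.domain_restrict, IntegralRep.domain_restrict]
      exact volume_lowerHalfCube_inter_upperHalfCube i
    · exact fun _ _ => rfl
    · exact fun _ _ => rfl
  -- rule (2): reflect the lower half onto the upper half; the target integrand is `−t`
  have hcov : of tL - of tU.neg ∈ relations := by
    refine of_sub_of_mem_relations_of_boxReflection i ?_ fun x hx => ?_
    · rw [htL, htU, IntegralRep.domain_neg, IntegralRep.domain_restrict,
        IntegralRep.domain_restrict]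
      exact oddRefl_lowerHalfCube_eq_preimage i
    · have hxL : x ∈ lowerHalfCube i := by
        rw [htL, IntegralRep.domain_restrict] at hx
        exact hx
      have h := hodd x (lowerHalfCube_subset i hxL)
      rw [oddRefl_update_eq_boxReflection] at h
      simp only [htL, htU, IntegralRep.integrand_neg, IntegralRep.integrand_restrict,
        Pi.neg_apply]
      rw [h, neg_neg]
  -- rule (1b): `[tU] + [tU.neg]`
  have hneg : of tU + of tU.neg ∈ relations :=
    levelRel_le_relations (of_add_of_neg_mem_levelRel tU)
  have e : of t = (of t - of tL - of tU) + (of tL - of tU.neg) + (of tU + of tU.neg) := by abel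
  rw [e]
  exact relations.add_mem (relations.add_mem hadd hcov) hneg

end Summit.KontsevichZagierPeriods.KontsevichZagierPeriods.Cruxes.CubeKernelStep.Layers

end
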